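import Summits.MatrixMultiplication.MatrixMultiplication.Theorems.AbelianSTPPCensusTALin1700Data3

/-!
# T_A/1700 certificate: kernel evaluation, volumes `1320 … 1425`

Cell mm-stpp (rung F-M1), T_A/1700 = «no abelian STPP host of order `≤ 1700` beats `τ = 2.371`»; checker in `AbelianSTPPCensusTALin1700Defs.lean`,
checkpoint states in `…TALin1700Data1/2/3.lean`.  `decide` with kernel reduction (standard axioms; no `native_decide`); at most `150` sorted
candidate shapes per segment (× 500 orders) and `Elab.async false` — the safe size at the gate (cf. the T_A/1200 chain).  Each segment
recomputes the next checkpoint from the previous one and checks every sorted candidate shape of its volumes at every order `1201 … 1700`; consumed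
by `TALin1700.seg_sound` / `TALin1700.loopL_sound` in `AbelianSTPPCensusLeafTA1700Closed.lean`.
WHAT THIS IS NOT: arithmetic on shape lists only; no statement about STPP families or `ω`.
-/

set_option linter.dupNamespace false
set_option autoImplicit false
set_option Elab.async false

namespace Summit.MatrixMultiplication.MatrixMultiplication.Theorems.TALin1700

set_option maxHeartbeats 0 in
/-- Segment `1320 … 1343` (136 sorted shapes): from `st1319` the loop reaches `st1343`, all checks at orders `1201 … 1700` passing. [original] -/
theorem sg1320 : loopL 1201 500 24 1320 st1319 = (true, st1343) := by decide +kernel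

set_option maxHeartbeats 0 in
/-- Segment `1344 … 1367` (145 sorted shapes): from `st1343` the loop reaches `st1367`, all checks at orders `1201 … 1700` passing. [original] -/
theorem sg1344 : loopL 1201 500 24 1344 st1343 = (true, st1367) := by decide +kernel

set_option maxHeartbeats 0 in
/-- Segment `1368 … 1394` (144 sorted shapes): from `st1367` the loop reaches `st1394`, all checks at orders `1201 … 1700` passing. [original] -/
theorem sg1368 : loopL 1201 500 27 1368 st1367 = (true, st1394) := by decide +kernel

set_option maxHeartbeats 0 in
/-- Segment `1395 … 1425` (150 sorted shapes): from `st1394` the loop reaches `st1425`, all checks at orders `1201 … 1700` passing. [original] -/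
theorem sg1395 : loopL 1201 500 31 1395 st1394 = (true, st1425) := by decide +kernel

end Summit.MatrixMultiplication.MatrixMultiplication.Theorems.TALin1700
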